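import Summits.BirchSwinnertonDyer.BirchSwinnertonDyer.Theorems.ThetaPartnerAtTwoSignedKatoUpToAtTwoPointsLocalCover
import Literature.NumberTheory.EllipticCurves.PeriodIndexCorestrictionLocal
import HarnessLib

/-!
# Route `ThetaPartnerAtTwo` (TP2), crux K2R0P♭ `SignedMainConjectureCMTwoRankZeroOfPubOfFlat` (stmt-BirchSwinnertonDyer-26471; derived
# node K2r0P stmt-BirchSwinnertonDyer-24945), line `rankzero` v17, clause (S_PT) — brick B1 of the kernel route
# (`Cruxes/SignedMainConjectureCMTwoRankZeroOfPub/PT-DEEP-HALF-DESIGN-w2g4.md` §2 (b), §3): **the hypothesis H(z) of (PT♭)_layer, stated over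
# `ℚ_∞`, READ AT A FINITE LAYER `ℚ_n`**

HONEST FRAMING (cell `pub/bsd-wall`, W-ALL row 1; width seat `bsd-wall-tp2-p2-w2` g4, `--supports` only). THEOREMS ONLY (no definition, no named
fact, no instance, no `sorry`); closes no item; BSD is NOT proved by any of this.

## What is here

The (PT♭)_layer clause of the registered stub `stub_coreLowerCMTwo` (and of its factor (S_PT), `SignedLowerOffTwo.offTwoLower_of_poitouTateDeepTwo_of_zetaErlLower`)
quantifies over functionals `z : E(K_∞·K_v) →+ ℤ_p` satisfying
H(z): «for every `t ∈ Sel^ε(E/K_∞)`, every cocycle `φ` of `t` on `Gal(K̄/K_∞)`, every `Q ∈ E(K̄_v)` and `k` with `p^k Q ∈ A^ε = ⨆ₙ E^ε(K_n·K_v)` such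
that `φ` restricted to `Gal(K̄_v/K_∞·K_v)` is the Kummer cocycle `τ ↦ τQ − Q`: `z(p^k Q) ≡ 0 (mod p^k)`» (the Kummer values of `z` kill `res_v Sel^ε_∞`).
Any finite-level Poitou–Tate argument (Milne I Thm. 4.10 (b) over `ℚ_n`) consumes this hypothesis at the LAYER `K_n`:

* `kummerValue_eq_zero_of_signedSelmerLayer` — H(z) ⟹ H_n(z) for every `n`: «for every `y ∈ Sel^ε(E/K_n)` (`signedSelmerLayer`), every cocycle `ψ` of
  `y` on `Gal(K̄/K_n)`, every `Q ∈ E(K̄_v)` and `k` with `p^k Q ∈ E^ε(K_n·K_v)` such that `ψ` restricted to `Gal(K̄_v/K_n·K_v)` is the Kummer cocycle of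
  `Q`: `z(p^k Q) ≡ 0 (mod p^k)`» — restriction `Sel^ε(E/K_n) → Sel^ε(E/K_∞)` (`layerToInfty`, `map_layerToInfty_signedSelmerLayer_le`) on explicit cocycles
  (`resH1Hom_oneCocycleClass`: the restricted class is represented by the pulled-back cocycle) and `Gal(K̄_v/K_∞·K_v) ≤ Gal(K̄_v/K_n·K_v)`.
  Any prime `p`, number field `K`, sign `ε`; the `p = 2`, `K = ℚ`, `ε = +` instance is the one (S_PT) needs.

References: [Kobayashi2003] Def. 1.1, §2 p. 4 (Kummer map), (7.17)–(7.20), Thm. 7.3 (pp. 12–13); [MilneADT2006] Ch. I Thm. 4.10 (b);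
[SerreGaloisCohomology1997] I §2.4–§2.5, I §5.1.
-/

set_option autoImplicit false
-- the Theorems namespace of this sub repeats the summit name by design (D-0017 nested layout)
set_option linter.dupNamespace false

noncomputable section

open scoped Classical

namespace Summit.BirchSwinnertonDyer.BirchSwinnertonDyer.Theorems

namespace SignedLowerOffTwo.PTDeep

open NumberField IsDedekindDomain Field WeierstrassCurve
  Literature.NumberTheory.EllipticCurves Literature.NumberTheory.EllipticCurves.Kobayashi2003
  Literature.NumberTheory.EllipticCurves.GreenbergSelmer
  Literature.NumberTheory.EllipticCurves.Sprung2012 Literature.NumberTheory.GaloisRepresentations ZpExtension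

universe u

variable {K : Type u} [Field K] [NumberField K] (W : WeierstrassCurve K) [W.IsElliptic] (p : ℕ) [Fact p.Prime]
  (κ : ZpExtension K p) (ε : ℤˣ) (v : HeightOneSpectrum (𝓞 K))

omit [W.IsElliptic] in
/-- **H(z) at the layer `K_n`.** If the Kummer values of a functional `z` on the local tower points `E(K_∞·K_v)` kill `res_v Sel^ε(E/K_∞)` (the hypothesis
of the (PT♭)_layer clause, verbatim in its `p`-generic form), then they kill `res_v Sel^ε(E/K_n)` for every layer `n`: for `y ∈ Sel^ε(E/K_n)` with cocycle
`ψ`, and `Q ∈ E(K̄_v)` with `p^k Q ∈ E^ε(K_n·K_v)` such that `ψ|_{Gal(K̄_v/K_n·K_v)}` is the Kummer cocycle of `Q`, `z(p^k Q) ≡ 0 (mod p^k)` (as an element of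
`ℚ/ℤ`: `(z(p^kQ) mod p^k)·p^{-k} = 0`). Proof: apply H(z) to `t = res y ∈ Sel^ε(E/K_∞)` (`map_layerToInfty_signedSelmerLayer_le`) represented by the
pulled-back cocycle (`resH1Hom_oneCocycleClass`), whose restriction to `Gal(K̄_v/K_∞·K_v) ≤ Gal(K̄_v/K_n·K_v)` is still the Kummer cocycle of `Q`.
[cite: Kobayashi2003, Def. 1.1, §2 (p. 4), (7.17) (p. 12)] [cite: SerreGaloisCohomology1997, I §2.5 and I §5.1] -/
theorem kummerValue_eq_zero_of_signedSelmerLayer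
    (z : localTowerPointsOfEmb κ (closureEmb (K := K) (v.adicCompletion K)) W →+ ℤ_[p])
    (hz : ∀ (t : W.subgroupH1 p κ.kerSubgroup), t ∈ signedSelmerInfty W κ ε →
      ∀ (φ : contOneCocycles (discreteTopRep κ.kerSubgroup (W.geomPrimaryTorsion p)))
        (Q : localPoints W (v.adicCompletion K)) (k : ℕ), oneCocycleClass _ φ = t →
      ∀ hQ : p ^ k • Q ∈ (⨆ n, signedLocalPoints κ (v.adicCompletion K) W ε n),
      (∀ τ : localSubgroupOfEmb κ.kerSubgroup (closureEmb (K := K) (v.adicCompletion K)),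
        pointsMapOfEmb W (closureEmb (K := K) (v.adicCompletion K))
            ((φ.1 (resGalSubgroupOfEmb κ.kerSubgroup _ τ) : W.geomPrimaryTorsion p) : W.geomPoints) =
          (τ : Field.absoluteGaloisGroup (v.adicCompletion K)) • Q - Q) →
      (PadicInt.toZModPow k
          (z ⟨p ^ k • Q, SignedKatoOffTwo.KummerPoint.iSup_signedLocalPoints_le_localTowerPointsOfEmb W p κ ε v hQ⟩)).val •
        ((((p : ℚ) ^ k)⁻¹ : ℚ) : AddCircle (1 : ℚ)) = 0)
    (n : ℕ) {y : W.subgroupH1 p (κ.layerSubgroup n)} (hy : y ∈ signedSelmerLayer W κ ε n)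
    (ψ : contOneCocycles (discreteTopRep (κ.layerSubgroup n) (W.geomPrimaryTorsion p)))
    (Q : localPoints W (v.adicCompletion K)) (k : ℕ) (hψ : oneCocycleClass _ ψ = y)
    (hQ : p ^ k • Q ∈ signedLocalPoints κ (v.adicCompletion K) W ε n)
    (hloc : ∀ τ : localSubgroupOfEmb (κ.layerSubgroup n) (closureEmb (K := K) (v.adicCompletion K)),
      pointsMapOfEmb W (closureEmb (K := K) (v.adicCompletion K))
          ((ψ.1 (resGalSubgroupOfEmb (κ.layerSubgroup n) _ τ) : W.geomPrimaryTorsion p) : W.geomPoints) =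
        (τ : Field.absoluteGaloisGroup (v.adicCompletion K)) • Q - Q) :
    (PadicInt.toZModPow k
        (z ⟨p ^ k • Q, localLayerPointsOfEmb_le_localTowerPointsOfEmb κ _ W n (signedLocalPointsOfEmb_le κ _ W ε n hQ)⟩)).val •
      ((((p : ℚ) ^ k)⁻¹ : ℚ) : AddCircle (1 : ℚ)) = 0 := by
  -- `p^k Q` lies in `A^ε = ⨆ₙ E^ε(K_n·K_v)`
  have hQ' : p ^ k • Q ∈ ⨆ m, signedLocalPoints κ (v.adicCompletion K) W ε m :=
    (le_iSup (fun m ↦ signedLocalPoints κ (v.adicCompletion K) W ε m) n) hQ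
  -- the restricted class `res y ∈ Sel^ε(E/K_∞)` and its pulled-back cocycle
  have hmem : W.layerToInfty κ n y ∈ signedSelmerInfty W κ ε :=
    map_layerToInfty_signedSelmerLayer_le W κ ε n ⟨y, hy, rfl⟩
  let φ : contOneCocycles (discreteTopRep κ.kerSubgroup (W.geomPrimaryTorsion p)) :=
    contOneCocycles.pullback (subgroupInclusion (κ.kerSubgroup_le_layerSubgroup n))
      (resHomOfEquivariant (subgroupInclusion (κ.kerSubgroup_le_layerSubgroup n))
        (AddMonoidHom.id (W.geomPrimaryTorsion p)) fun _ _ ↦ rfl) ψ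
  have hφ : oneCocycleClass _ φ = W.layerToInfty κ n y := by
    rw [← hψ]
    exact (resH1Hom_oneCocycleClass (subgroupInclusion (κ.kerSubgroup_le_layerSubgroup n))
      (AddMonoidHom.id (W.geomPrimaryTorsion p)) (fun _ _ ↦ rfl) ψ).symm
  -- its restriction to `Gal(K̄_v/K_∞·K_v)` is the Kummer cocycle of `Q`
  have hlocφ : ∀ τ : localSubgroupOfEmb κ.kerSubgroup (closureEmb (K := K) (v.adicCompletion K)),
      pointsMapOfEmb W (closureEmb (K := K) (v.adicCompletion K))
          ((φ.1 (resGalSubgroupOfEmb κ.kerSubgroup _ τ) : W.geomPrimaryTorsion p) : W.geomPoints) =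
        (τ : Field.absoluteGaloisGroup (v.adicCompletion K)) • Q - Q := by
    intro τ
    have hτ : resGalOfEmb (closureEmb (K := K) (v.adicCompletion K)) (τ : Field.absoluteGaloisGroup (v.adicCompletion K)) ∈
        κ.layerSubgroup n :=
      κ.kerSubgroup_le_layerSubgroup n τ.2
    exact hloc ⟨(τ : Field.absoluteGaloisGroup (v.adicCompletion K)), hτ⟩
  exact hz (W.layerToInfty κ n y) hmem φ Q k hφ hQ' hlocφ

end SignedLowerOffTwo.PTDeep

end Summit.BirchSwinnertonDyer.BirchSwinnertonDyer.Theorems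

end
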